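import Summits.QuantumFields.BalabanUV.T4Continuum.Support.NE7EtaBackgroundEnergyClass
import Summits.QuantumFields.BalabanUV.T4Continuum.Support.NE7EtaBackgroundClosenessHolder
import HarnessLib

/-!
# NE7EtaBackgroundEnergyClassHolder — route #1 of the NE7 crux (node U5), socket `h` AMENDMENT 5 (ROAD-G106 §4): gen 63's `NE7EtaBackgroundEnergyClass`
# (`hclose` on the energy class (H∃)ᴱ, with and without reference datum) RE-DERIVED FROM THE AMENDED SOCKET `h′` = (E) + (Lip₁ᶜ) + (Höl½ᶜ), rate base
# `θ^{18} = L⁻¹`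

Cell `pub-balaban`, rung (B)+1 sub-cell t4, lineage `b2b-balaban-t4-ne7-p1`, generation 106 (CRUX PROVER NE7 #1 = OWNER of BINDER row NE7).
Memo `t4/b2b-balaban-t4-ne7-p1-g106/ROAD-G106.md` §4.
WHAT ([folklore]; 0 def, 0 sorry).  `hexB_of_hminE18` — the smooth-gauge letter of the run-B minimiser at base 18 (`‖A_B‖ ≤ gaugeConst n·(N⁻¹ + N·b)·θ^{18(K+1)}`,
`NE7EtaBackgroundGaugeLetterDischarge.hletter_holds` at `ϑ = θ³`); **`hclose_of_hminEH`**, **`hclose_of_hminE_refH`** — statements of gen 63's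
`hclose_of_hminE` ∕ `hclose_of_hminE_ref` VERBATIM except `hθ18`, the socket `h′` (last conjunct (Höl½ᶜ) with `Λ_H`, `0 ≤ Λ_H` where a sign is
asked) — conclusions VERBATIM.
HONEST FRAMING (page 1): bookkeeping ([folklore]); `h′` and (H∃)ᴱ are HYPOTHESES here ((H∃)ᴱ is a theorem at SU(2), gen 104); nothing of NE3∕NE7
discharged; nothing of Bałaban's asserted as an axiom; spine count = dagwriter∕referees' call; FIXED FINITE T⁴, rung (B)+1 — NOT infinite volume, NOT
mass gap, NOT BetaPertH, NOT Clay.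
-/

set_option autoImplicit false

open scoped BigOperators Matrix Matrix.Norms.L2Operator
open Finset NormedSpace

namespace Summit.QuantumFields.BalabanUV.T4Continuum.NE7EtaBackgroundEnergyClassHolder

open Literature.MathematicalPhysics.QuantumFieldTheory.Balaban1983to89
open B7Prop1Explicit B7Prop2Explicit
open T4AveragingDeficitWall hiding Site Plane Plaq Bond
open T4AveragingDeficitWallBoundary (periodBox IsPeriodicCfg)
open MinimalActionSandwich (IsMinimiser admissible)
open MinimalActionRate (Regular sfClass)
open AveragingDeficitPeriodicCounting (IsPeriodicDir)
open AveragingDeficitTwoLevelPrep (twoLevelSmall)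
open AveragingDeficitMultiLevelPrep (LevelSmall)
open NE3EnergyShapes (residualScale residualScale_nonneg IsUnitarySite IsPeriodicSite)
open NE3EnergyWeightedShapes (energyNormW)
open AveragingDeficitDualResidual (dualC1 dualC2)
open AveragingDeficitDerivWallProof (wallConst)
open NE7EtaBackgroundCarrier
open TorusSmallFieldGlobalGauge (sectorConst gaugeConst sectorConst_pos)
open NE7EtaBackgroundGaugeLetterDischarge (hletter_holds)
open NE7EtaBackgroundLevelSmallDischarge (levelSmall_hls)
open NE7EtaBackgroundReferenceWitness (gauge_refPair)
open NE7EtaBackgroundEnergyClass (hexA_of_hminE)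
open NE7EtaBackgroundClosenessHolder (hclose_of_covRootH_occ)
open NE7EtaClosenessHolder (covRootH_mono)
open NE7EtaRatesD4Holder (cube_pow_six)

noncomputable section

variable {n : Type} [Fintype n] [DecidableEq n] [Nonempty n]

/-! ## §1 The smooth-gauge letter of `hexB` at base 18 -/

/-- **hexB ON (H∃)ᴱ AT BASE 18**: `NE7EtaBackgroundEnergyClass.hexB_of_hminE` at `ϑ = θ³` (`ϑ⁶ = L⁻¹`), the letter read as `σ_B·θ^{18(K+1)}`. [folklore] -/
theorem hexB_of_hminE18 {L N : ℕ} (hL : 2 ≤ L) (hN : 1 ≤ N) {θ : ℝ} (hθ18 : θ ^ 18 = ((L : ℝ))⁻¹) {ε b g : ℝ}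
    (hb : 0 ≤ b) (hbε : b ≤ ε) {dom : Set (Site 4 → Fin 4 → (Matrix n n ℂ)ˣ)}
    (hminE : ∀ V ∈ dom, ∀ k : ℕ, ∃ U, IsMinimiser 4 (sfClass 4 L N ε) L N k V U ∧ Regular 4 L N b g k U) :
    ∀ K : ℕ, 1 ≤ K → ∀ v ∈ dom, (Fintype.card n : ℝ) * (N : ℝ) ^ 2 * ε ≤ sectorConst n →
      ∃ UB : Site 4 → Fin 4 → (Matrix n n ℂ)ˣ, IsMinimiser 4 (sfClass 4 L N ε) L N (K + 1) v UB ∧ Regular 4 L N b g (K + 1) UB ∧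
        ∃ uB : Site 4 → (Matrix n n ℂ)ˣ, IsUnitarySite uB ∧ IsPeriodicSite uB ((N * L ^ (K + 1) : ℕ) : ℤ) ∧
          ∃ AB : Site 4 → Fin 4 → Matrix n n ℂ, ∀ (x : Site 4) (κ : Fin 4),
            ((gaugeAct uB UB x κ : (Matrix n n ℂ)ˣ) : Matrix n n ℂ) = exp (AB x κ) ∧
              ‖AB x κ‖ ≤ (gaugeConst n * (((N : ℝ))⁻¹ + (N : ℝ) * b)) * θ ^ (18 * (K + 1)) := by
  intro K hK v hv hsec
  obtain ⟨UB, hUB, hreg⟩ := hminE v hv (K + 1)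
  obtain ⟨uB, hu, huP, AB, hAB⟩ := hletter_holds (dom := dom) hL hN (cube_pow_six hθ18) hb hbε K hK v hv UB hUB hreg hsec
  refine ⟨UB, hUB, hreg, uB, hu, huP, AB, fun x κ => ⟨(hAB x κ).1, ?_⟩⟩
  have e : (θ ^ 3) ^ (6 * (K + 1)) = θ ^ (18 * (K + 1)) := by rw [← pow_mul]; ring_nf
  rw [← e]
  exact (hAB x κ).2

/-! ## §2 `hclose` on (H∃)ᴱ from `h′` -/

/-- **NODE O's `hclose` BINDER ON (H∃)ᴱ FROM THE AMENDED SOCKET `h′`** — `NE7EtaBackgroundEnergyClass.hclose_of_hminE` with `hθ18`, the socket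
`h′` ((E) + (Lip₁ᶜ) + (Höl½ᶜ), `0 ≤ Λ_H`) and the base-18 smooth-gauge letter; conclusion VERBATIM (`hclose_of_covRootH_occ` ∘ `hexA_of_hminE` ∘
`hexB_of_hminE18`).  NE3∕NE7 NOT proved. [folklore] -/
theorem hclose_of_hminEH {L N : ℕ} (hL : 2 ≤ L) (hN : 1 ≤ N) {θ : ℝ} (hθ : 0 < θ)
    (hθ18 : θ ^ 18 = ((L : ℝ))⁻¹) {ε b : ℝ} (hb : 0 ≤ b) (hbε : b ≤ ε)
    (hbs : 512 * (4 + 1) * (4 + 4) * (L : ℝ) ^ 2 * b ≤ 1)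
    (hε1 : 16 * C0 4 * ε ≤ 3) (h2line : 2 * twoLevelSmall 4 L * ε ≤ (L : ℝ) ^ 2)
    {g C Λ₁ ΛH : ℝ} (hg : 0 ≤ g) (hC : 0 ≤ C) (hΛH : 0 ≤ ΛH)
    {dom : Set (Site 4 → Fin 4 → (Matrix n n ℂ)ˣ)}
    (hdom : ∀ v ∈ dom, ∀ w : Site 4 → (Matrix n n ℂ)ˣ, IsUnitarySite w → IsPeriodicSite w (N : ℤ) → gaugeAct w v ∈ dom)
    (hminE : ∀ V ∈ dom, ∀ k : ℕ, ∃ U, IsMinimiser 4 (sfClass 4 L N ε) L N k V U ∧ Regular 4 L N b g k U)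
    (h : ∀ k : ℕ, 1 ≤ k → ∀ V ∈ dom, ∀ UA UB : Site 4 → Fin 4 → (Matrix n n ℂ)ˣ,
      IsMinimiser 4 (sfClass 4 L N ε) L N k V UA → IsMinimiser 4 (sfClass 4 L N ε) L N (k + 1) V UB →
        Regular 4 L N b g (k + 1) UB →
        ∃ (u : Site 4 → (Matrix n n ℂ)ˣ) (Z : Site 4 → Fin 4 → Matrix n n ℂ),
          IsUnitarySite u ∧ IsPeriodicSite u ((N * L ^ k : ℕ) : ℤ) ∧
          IsSkewDir Z ∧ IsPeriodicDir Z ((N * L ^ k : ℕ) : ℤ) ∧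
          gaugeAct u UA = vary (rescale L (bavg L UB)) Z 1 ∧
          energyNormW L k (rescale L (bavg L UB)) Z (periodBox (N * L ^ k)) ≤ C * residualScale 4 L N b g k ∧
          (∀ (κ : Fin 4) (x : Site 4) (μ : Fin 4),
            ‖Ad (rescale L (bavg L UB) (x + e κ) μ) (Z (x + e μ) κ) - Z x κ‖ ≤ Λ₁ * (((L : ℝ)⁻¹) ^ k) ^ 2) ∧
          (∀ (κ μ : Fin 4) (y : Site 4) (j : ℕ),
            ‖Ad (((List.range j).map fun i : ℕ => rescale L (bavg L UB) (y + e κ + i • e μ) μ).prod)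
                  (Ad (rescale L (bavg L UB) (y + j • e μ + e κ) μ) (Z (y + j • e μ + e μ) κ) - Z (y + j • e μ) κ)
                - (Ad (rescale L (bavg L UB) (y + e κ) μ) (Z (y + e μ) κ) - Z y κ)‖
              ≤ ΛH * Real.sqrt (j : ℝ) * (((L : ℝ)⁻¹) ^ k) ^ 2 * Real.sqrt (((L : ℝ)⁻¹) ^ k)))
    {γ l₁ : ℝ} (hγ : 0 < γ)
    (hγ3 : C * (wallConst 4 L * (N : ℝ) ^ 2 * (Real.sqrt g * dualC2 4 L + 2 * b ^ 2 * dualC1 4 L)) ≤ γ ^ 3)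
    (hl₁ : 0 < l₁) (hΛl₁ : Λ₁ ≤ l₁ ^ 3)
    (hsector : (Fintype.card n : ℝ) * (N : ℝ) ^ 2 * ε ≤ sectorConst n)
    (D : Type) (sc : D → ℕ) (dl : D → ℝ) (hdl : ∀ X, 0 ≤ dl X) :
    ∃ (uA : ℕ → (Site 4 → Fin 4 → (Matrix n n ℂ)ˣ) → (occCarriers n L N ε dom D sc dl hdl).BgA)
      (uB : ℕ → (Site 4 → Fin 4 → (Matrix n n ℂ)ˣ) → (occCarriers n L N ε dom D sc dl hdl).BgB) (K₀ : ℕ) (C₃ : ℝ),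
      0 ≤ C₃ ∧
      (∀ K : ℕ, K₀ ≤ K → ∀ v ∈ dom, ∃ (UA UB : Site 4 → Fin 4 → (Matrix n n ℂ)ˣ) (wA wB : Site 4 → (Matrix n n ℂ)ˣ),
        IsMinimiser 4 (sfClass 4 L N ε) L N K v UA ∧ IsMinimiser 4 (sfClass 4 L N ε) L N (K + 1) v UB ∧
        Regular 4 L N b g (K + 1) UB ∧ IsUnitarySite wA ∧ IsPeriodicSite wA ((N * L ^ K : ℕ) : ℤ) ∧
        IsUnitarySite wB ∧ IsPeriodicSite wB ((N * L ^ (K + 1) : ℕ) : ℤ) ∧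
        (uA K v).1 = (K, gaugeAct wA UA) ∧ (uB K v).1 = (K, gaugeAct wB UB)) ∧
      (∀ (K : ℕ) (v : Site 4 → Fin 4 → (Matrix n n ℂ)ˣ), ¬ (K₀ ≤ K ∧ v ∈ dom) →
        (uA K v).1 = (K, 1) ∧ (uB K v).1 = (K, 1)) ∧
      ∀ K : ℕ, ∀ v ∈ dom, (occCarriers n L N ε dom D sc dl hdl).gauge (uA K v)
          ((occCarriers n L N ε dom D sc dl hdl).transport (uB K v))
        ≤ C₃ * θ ^ K := by
  have hε : 0 ≤ ε := hb.trans hbε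
  have hN0 : (0 : ℝ) < N := by exact_mod_cast hN
  have hσB : 0 ≤ gaugeConst n * (((N : ℝ))⁻¹ + (N : ℝ) * b) := by
    have := (sectorConst_pos (n := n)).2
    positivity
  exact hclose_of_covRootH_occ hL hN hθ hθ18 hε (levelSmall_hls hL hε hε1 h2line) hb hbs hg hC hΛH hdom h hγ hγ3 hl₁ hΛl₁
    (hexA_of_hminE hminE) hσB hsector (hexB_of_hminE18 hL hN hθ18 hb hbε hminE) D sc dl hdl

/-! ## §3 The `hclose` binder with the reference datum, on (H∃)ᴱ -/

/-- **NODE O's `hclose` BINDER WITH A REFERENCE DATUM, ON (H∃)ᴱ, FROM THE AMENDED SOCKET `h′`** — `NE7EtaBackgroundEnergyClass.hclose_of_hminE_ref`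
with `hθ18` and the socket `h′` (ANY real `C, Λ₁, Λ_H`; the sign letters shed by `covRootH_mono`); CONCLUSION VERBATIM. [folklore] -/
theorem hclose_of_hminE_refH {L N : ℕ} (hL : 2 ≤ L) (hN : 1 ≤ N) {θ : ℝ} (hθ : 0 < θ)
    (hθ18 : θ ^ 18 = ((L : ℝ))⁻¹) {ε b : ℝ} (hb : 0 ≤ b) (hbε : b ≤ ε)
    (hbs : 512 * (4 + 1) * (4 + 4) * (L : ℝ) ^ 2 * b ≤ 1)
    (hε1 : 16 * C0 4 * ε ≤ 3) (h2line : 2 * twoLevelSmall 4 L * ε ≤ (L : ℝ) ^ 2)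
    {g C Λ₁ ΛH : ℝ} (hg : 0 ≤ g)
    {dom : Set (Site 4 → Fin 4 → (Matrix n n ℂ)ˣ)}
    (hdom : ∀ v ∈ dom, ∀ w : Site 4 → (Matrix n n ℂ)ˣ, IsUnitarySite w → IsPeriodicSite w (N : ℤ) → gaugeAct w v ∈ dom)
    (hminE : ∀ V ∈ dom, ∀ k : ℕ, ∃ U, IsMinimiser 4 (sfClass 4 L N ε) L N k V U ∧ Regular 4 L N b g k U)
    (h : ∀ k : ℕ, 1 ≤ k → ∀ V ∈ dom, ∀ UA UB : Site 4 → Fin 4 → (Matrix n n ℂ)ˣ,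
      IsMinimiser 4 (sfClass 4 L N ε) L N k V UA → IsMinimiser 4 (sfClass 4 L N ε) L N (k + 1) V UB →
        Regular 4 L N b g (k + 1) UB →
        ∃ (u : Site 4 → (Matrix n n ℂ)ˣ) (Z : Site 4 → Fin 4 → Matrix n n ℂ),
          IsUnitarySite u ∧ IsPeriodicSite u ((N * L ^ k : ℕ) : ℤ) ∧
          IsSkewDir Z ∧ IsPeriodicDir Z ((N * L ^ k : ℕ) : ℤ) ∧
          gaugeAct u UA = vary (rescale L (bavg L UB)) Z 1 ∧
          energyNormW L k (rescale L (bavg L UB)) Z (periodBox (N * L ^ k)) ≤ C * residualScale 4 L N b g k ∧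
          (∀ (κ : Fin 4) (x : Site 4) (μ : Fin 4),
            ‖Ad (rescale L (bavg L UB) (x + e κ) μ) (Z (x + e μ) κ) - Z x κ‖ ≤ Λ₁ * (((L : ℝ)⁻¹) ^ k) ^ 2) ∧
          (∀ (κ μ : Fin 4) (y : Site 4) (j : ℕ),
            ‖Ad (((List.range j).map fun i : ℕ => rescale L (bavg L UB) (y + e κ + i • e μ) μ).prod)
                  (Ad (rescale L (bavg L UB) (y + j • e μ + e κ) μ) (Z (y + j • e μ + e μ) κ) - Z (y + j • e μ) κ)
                - (Ad (rescale L (bavg L UB) (y + e κ) μ) (Z (y + e μ) κ) - Z y κ)‖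
              ≤ ΛH * Real.sqrt (j : ℝ) * (((L : ℝ)⁻¹) ^ k) ^ 2 * Real.sqrt (((L : ℝ)⁻¹) ^ k)))
    (hsector : (Fintype.card n : ℝ) * (N : ℝ) ^ 2 * ε ≤ sectorConst n)
    (v₁ : Site 4 → Fin 4 → (Matrix n n ℂ)ˣ)
    (D : Type) (sc : D → ℕ) (dl : D → ℝ) (hdl : ∀ X, 0 ≤ dl X) :
    ∃ (uA : ℕ → (Site 4 → Fin 4 → (Matrix n n ℂ)ˣ) → (occCarriers n L N ε dom D sc dl hdl).BgA)
      (uB : ℕ → (Site 4 → Fin 4 → (Matrix n n ℂ)ˣ) → (occCarriers n L N ε dom D sc dl hdl).BgB) (K₀ : ℕ) (C₃ : ℝ),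
      0 ≤ C₃ ∧
      (∀ K : ℕ, K₀ ≤ K → ∀ v ∈ dom, v ≠ v₁ → ∃ (UA UB : Site 4 → Fin 4 → (Matrix n n ℂ)ˣ) (wA wB : Site 4 → (Matrix n n ℂ)ˣ),
        IsMinimiser 4 (sfClass 4 L N ε) L N K v UA ∧ IsMinimiser 4 (sfClass 4 L N ε) L N (K + 1) v UB ∧
        Regular 4 L N b g (K + 1) UB ∧ IsUnitarySite wA ∧ IsPeriodicSite wA ((N * L ^ K : ℕ) : ℤ) ∧
        IsUnitarySite wB ∧ IsPeriodicSite wB ((N * L ^ (K + 1) : ℕ) : ℤ) ∧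
        (uA K v).1 = (K, gaugeAct wA UA) ∧ (uB K v).1 = (K, gaugeAct wB UB)) ∧
      (∀ (K : ℕ) (v : Site 4 → Fin 4 → (Matrix n n ℂ)ˣ), ¬ (K₀ ≤ K ∧ v ∈ dom ∧ v ≠ v₁) →
        uA K v = ⟨((0 : ℕ), (1 : Site 4 → Fin 4 → (Matrix n n ℂ)ˣ)), one_mem_occA L N ε dom 0⟩ ∧
        uB K v = ⟨((0 : ℕ), (1 : Site 4 → Fin 4 → (Matrix n n ℂ)ˣ)), one_mem_occB L N ε dom 0⟩) ∧
      (∀ K : ℕ, uA K v₁ = ⟨((0 : ℕ), (1 : Site 4 → Fin 4 → (Matrix n n ℂ)ˣ)), one_mem_occA L N ε dom 0⟩ ∧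
        uB K v₁ = ⟨((0 : ℕ), (1 : Site 4 → Fin 4 → (Matrix n n ℂ)ˣ)), one_mem_occB L N ε dom 0⟩) ∧
      ∀ K : ℕ, ∀ v ∈ dom, (occCarriers n L N ε dom D sc dl hdl).gauge (uA K v)
          ((occCarriers n L N ε dom D sc dl hdl).transport (uB K v))
        ≤ C₃ * θ ^ K := by
  classical
  -- shed the sign letters: the root with `C⁺ := max C 0`, `Λ_H⁺ := max Λ_H 0`
  have hC' : 0 ≤ max C 0 := le_max_right _ _
  have hΛ₂'' : 0 ≤ max ΛH 0 := le_max_right _ _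
  have h' := covRootH_mono (𝒞 := sfClass 4 L N ε) (le_max_left C 0) (le_refl Λ₁) (le_max_left ΛH 0) h
  -- shed the budget letters: choose `γ`, `l₁`
  set ρ₄ : ℝ := wallConst 4 L * (N : ℝ) ^ 2 * (Real.sqrt g * dualC2 4 L + 2 * b ^ 2 * dualC1 4 L) with hρ₄
  set γ : ℝ := max (max C 0 * ρ₄) 1 with hγdef
  have hγ1 : 1 ≤ γ := le_max_right _ _
  have hγ3 : max C 0 * ρ₄ ≤ γ ^ 3 := (le_max_left _ _).trans (le_self_pow₀ hγ1 (by norm_num))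
  set l₁ : ℝ := max Λ₁ 1 with hl₁def
  have hl₁1 : 1 ≤ l₁ := le_max_right _ _
  have hΛl₁ : Λ₁ ≤ l₁ ^ 3 := (le_max_left _ _).trans (le_self_pow₀ hl₁1 (by norm_num))
  -- the chain on (H∃)ᴱ
  obtain ⟨uA, uB, K₀, C₃, hC₃, hspec, hoff, hclose⟩ := hclose_of_hminEH hL hN hθ hθ18 hb hbε hbs hε1 h2line hg hC' hΛ₂'' hdom
    hminE h' (lt_of_lt_of_le one_pos hγ1) hγ3 (lt_of_lt_of_le one_pos hl₁1) hΛl₁ hsector D sc dl hdl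
  -- the re-cut selections
  refine ⟨fun K v => if K₀ ≤ K ∧ v ∈ dom ∧ v ≠ v₁ then uA K v
      else ⟨((0 : ℕ), (1 : Site 4 → Fin 4 → (Matrix n n ℂ)ˣ)), one_mem_occA L N ε dom 0⟩,
    fun K v => if K₀ ≤ K ∧ v ∈ dom ∧ v ≠ v₁ then uB K v
      else ⟨((0 : ℕ), (1 : Site 4 → Fin 4 → (Matrix n n ℂ)ˣ)), one_mem_occB L N ε dom 0⟩, K₀, C₃, hC₃, ?_, ?_, ?_, ?_⟩
  · -- (a) gauge copies of a minimiser pair for the datum itself, off the reference datum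
    intro K hK v hv hne
    have hKv : K₀ ≤ K ∧ v ∈ dom ∧ v ≠ v₁ := ⟨hK, hv, hne⟩
    obtain ⟨UA, UB, wA, wB, hA, hB, hreg, hwAu, hwAp, hwBu, hwBp, heA, heB⟩ := hspec K hK v hv
    refine ⟨UA, UB, wA, wB, hA, hB, hreg, hwAu, hwAp, hwBu, hwBp, ?_, ?_⟩
    · simp only [if_pos hKv]; exact heA
    · simp only [if_pos hKv]; exact heB
  · -- (b) the reference pair otherwise
    intro K v hKv
    exact ⟨by simp only [if_neg hKv], by simp only [if_neg hKv]⟩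
  · -- (b′) the reference datum reads the reference pair at every cutoff
    intro K
    have hKv : ¬ (K₀ ≤ K ∧ v₁ ∈ dom ∧ v₁ ≠ v₁) := fun h => h.2.2 rfl
    exact ⟨by simp only [if_neg hKv], by simp only [if_neg hKv]⟩
  · -- (c) `hclose`
    intro K v hv
    by_cases hKv : K₀ ≤ K ∧ v ∈ dom ∧ v ≠ v₁
    · simp only [if_pos hKv]
      exact hclose K v hv
    · simp only [if_neg hKv]
      rw [gauge_refPair]
      positivity

end

end Summit.QuantumFields.BalabanUV.T4Continuum.NE7EtaBackgroundEnergyClassHolder
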